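import Summits.ResolutionOfSingularities.ResolutionOfSingularities.Theorems.EquisingularLiftEquisingularLiftNatResidueHypDefsND
import HarnessLib

/-!
# [OURS · L1 W4.5(b) · EL♮(3) · D-0157 DOOR 1, WIDTH row iso-w4] FAN-GAME WINNABILITY — brick 1a: the ONE-WALL MEASURE

res-L1-w45b-iso-w4 g0 (prover, width seat; desk WIDTH TABLE D1/D1′ STATUS l.81504 / l.81520; referee crit-2).
`--supports stmt-ResolutionOfSingularities-20148 --as helper`. Def-light (five bookkeeping defs — a linear form, a crossing predicate, two
sums, a weight — no new mathematical notion), sorry-free, fact-free. OURS; counted 0; AI kernel work, weaker than expert review; NOT a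
statement of any manuscript; nothing of [Hironaka2017] is used; resolution of singularities in characteristic `p` is NOT proved here.

## Context: the row's theorem and why a legality-compatible schedule is needed

The row asks for «FAN-GAME WINNABILITY»: for every convenient non-empty exponent table `V` the E1-legal local fan game of
`…NatResidueHypDefsND` (`Reach`, `star`, `Bad`, `Won`, `orthantFan`) can be WON from the orthant — geometrically, the monomial ideal
`(x^m : m ∈ V)` is principalised by smooth toric blow-ups whose centres lie INSIDE its non-principal locus (E1-legality = `Bad`), an
E1-legal form of De Concini–Procesi domination [Ewald 1996, VI.7 Ex. 4] / of Goward's principalisation of monomial ideals [Goward 2005,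
Trans. AMS 357; generalised in Harris 2015, J. Comm. Alg. 7 §4].  Goward's pairwise codimension-2 schedule is NOT E1-legal as it stands
(a third generator may make the whole ideal principal along `Yᵢ ∩ Yⱼ`: for `V = {(0,2,5),(2,0,5),(0,0,9)}` no 2-face of the orthant is
`Bad`, only the 3-cone), so the row needs a schedule whose every star is at a `Bad` face AND whose termination survives the coupling of
the two maximal cones sharing a starred 2-face.

## This file: the measure of the ONE-WALL schedule (sequel: `…NatFanGameWinnable`)

Fix an integer vector `z`, the linear form `ℓ = ⟨·, z⟩` on rays, and call a cone CROSSING when `ℓ` takes a strictly positive and a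
strictly negative value on its rays.  The schedule (run in the sequel): star the crossing pair `{p, q}` (`ℓ p > 0 > ℓ q`, both in one
cone) that MAXIMISES `ℓ p − ℓ q` over the whole position — then `p` is the maximal and `q` the minimal ray of EVERY cone through `{p, q}`.
The measure: `Σ_{σ crossing} 3 ^ ((Σ⁺ σ)(Σ⁻ σ))`, `Σ±` the sums of the positive / negative parts of `ℓ` over the rays of `σ`.  PROVED here:
`FanGame.child_lt` / `child_lt'` (each child of a cone with at most three rays under the star at its extreme pair, if still crossing, has
strictly smaller `(Σ⁺)(Σ⁻)` — a case analysis that USES `card σ ≤ 3`; the analogue is false for four rays, values `(1,1,1,−5)`),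
`FanGame.weight_children_lt`, and `FanGame.measure_star_lt` (one such star strictly lowers the measure of the position; the finset
union/`biUnion` of `star` only merges cones, which only lowers sums).
-/

set_option linter.dupNamespace false

namespace Summit.ResolutionOfSingularities.ResolutionOfSingularities.Cruxes.EquisingularLiftNat.Sections

namespace FanGame

variable {n : ℕ}

/-! ### The linear form, crossing cones, the measure -/

/-- The linear form `ρ ↦ ⟨ρ, z⟩` on rays attached to an integer vector `z` (for the binomial game `z = a − b`, so that
`lin z ρ = pair ρ a − pair ρ b`). [OURS · bookkeeping] -/
def lin (z : Fin n → ℤ) (ρ : Ray n) : ℤ := ∑ i, ρ i * z i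

/-- A cone (finite set of rays) is `z`-CROSSING when the linear form `lin z` takes a strictly positive AND a strictly negative value on its
rays — the one-wall form of `Bad`. [OURS · bookkeeping] -/
def Crossing (z : Fin n → ℤ) (σ : Finset (Ray n)) : Prop :=
  (∃ p ∈ σ, 0 < lin z p) ∧ (∃ q ∈ σ, lin z q < 0)

/-- `Σ⁺ σ`: the sum of the positive parts of `lin z` over the rays of `σ`. [OURS · bookkeeping] -/
def posSum (z : Fin n → ℤ) (σ : Finset (Ray n)) : ℕ := ∑ ρ ∈ σ, (lin z ρ).toNat

/-- `Σ⁻ σ`: the sum of the negative parts of `lin z` over the rays of `σ`. [OURS · bookkeeping] -/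
def negSum (z : Fin n → ℤ) (σ : Finset (Ray n)) : ℕ := ∑ ρ ∈ σ, (-lin z ρ).toNat

open Classical in
/-- The weight of a cone: `3 ^ ((Σ⁺ σ)(Σ⁻ σ))` if it is crossing, `0` otherwise. [OURS · bookkeeping] -/
noncomputable def weight (z : Fin n → ℤ) (σ : Finset (Ray n)) : ℕ :=
  if Crossing z σ then 3 ^ (posSum z σ * negSum z σ) else 0

/-- The termination measure of a position: the total weight of its cones. [OURS · bookkeeping] -/
noncomputable def measure (z : Fin n → ℤ) (F : Finset (Finset (Ray n))) : ℕ := ∑ σ ∈ F, weight z σ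

/-- `⟨·, z⟩` is additive on rays — the new ray of a star carries the sum of the values. -/
theorem lin_add (z : Fin n → ℤ) (p q : Ray n) : lin z (p + q) = lin z p + lin z q := by
  simp only [lin, Pi.add_apply, add_mul, Finset.sum_add_distrib]

/-- `⟨·, -z⟩ = -⟨·, z⟩` (the symmetry exchanging the roles of the positive and the negative side). -/
theorem lin_neg (z : Fin n → ℤ) (ρ : Ray n) : lin (-z) ρ = -lin z ρ := by
  simp only [lin, Pi.neg_apply, mul_neg, Finset.sum_neg_distrib]

/-- Crossing is symmetric under `z ↦ -z`. -/
theorem crossing_neg_iff (z : Fin n → ℤ) (σ : Finset (Ray n)) : Crossing (-z) σ ↔ Crossing z σ := by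
  simp only [Crossing, lin_neg, Left.neg_pos_iff, Left.neg_neg_iff]
  exact And.comm

/-- `Σ⁺` for `-z` is `Σ⁻` for `z`. -/
theorem posSum_neg (z : Fin n → ℤ) (σ : Finset (Ray n)) : posSum (-z) σ = negSum z σ := by
  simp only [posSum, negSum, lin_neg]

/-- `Σ⁻` for `-z` is `Σ⁺` for `z`. -/
theorem negSum_neg (z : Fin n → ℤ) (σ : Finset (Ray n)) : negSum (-z) σ = posSum z σ := by
  simp only [posSum, negSum, lin_neg, neg_neg]

/-- A ray with `lin z ρ > 0` contributes at least `lin z ρ` to `Σ⁺`. -/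
theorem toNat_le_posSum (z : Fin n → ℤ) {σ : Finset (Ray n)} {ρ : Ray n} (hρ : ρ ∈ σ) :
    (lin z ρ).toNat ≤ posSum z σ :=
  Finset.single_le_sum (f := fun ρ => (lin z ρ).toNat) (fun _ _ => Nat.zero_le _) hρ

/-- `Σ⁺ σ > 0` iff some ray of `σ` has a positive value. -/
theorem posSum_pos_iff (z : Fin n → ℤ) (σ : Finset (Ray n)) : 0 < posSum z σ ↔ ∃ p ∈ σ, 0 < lin z p := by
  constructor
  · intro h
    obtain ⟨p, hp, hp0⟩ := Finset.exists_ne_zero_of_sum_ne_zero (Nat.pos_iff_ne_zero.1 h)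
    exact ⟨p, hp, by simpa [Int.toNat_eq_zero, not_le] using hp0⟩
  · rintro ⟨p, hp, hp0⟩
    exact lt_of_lt_of_le (by simpa using hp0) (toNat_le_posSum z hp)

/-- `Σ⁻ σ > 0` iff some ray of `σ` has a negative value. -/
theorem negSum_pos_iff (z : Fin n → ℤ) (σ : Finset (Ray n)) : 0 < negSum z σ ↔ ∃ q ∈ σ, lin z q < 0 := by
  rw [← posSum_neg, posSum_pos_iff]
  simp only [lin_neg, Left.neg_pos_iff]

/-- A cone is crossing iff both `Σ⁺` and `Σ⁻` are positive. -/
theorem crossing_iff_pos (z : Fin n → ℤ) (σ : Finset (Ray n)) : Crossing z σ ↔ 0 < posSum z σ ∧ 0 < negSum z σ := by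
  rw [Crossing, posSum_pos_iff, negSum_pos_iff]


/-! ### Sums over small cones -/

/-- `Σ⁺` of `insert u s`, `u ∉ s`. -/
theorem posSum_insert (z : Fin n → ℤ) {s : Finset (Ray n)} {u : Ray n} (h : u ∉ s) :
    posSum z (insert u s) = (lin z u).toNat + posSum z s := by
  unfold posSum; rw [Finset.sum_insert h]

/-- `Σ⁻` of `insert u s`, `u ∉ s`. -/
theorem negSum_insert (z : Fin n → ℤ) {s : Finset (Ray n)} {u : Ray n} (h : u ∉ s) :
    negSum z (insert u s) = (-lin z u).toNat + negSum z s := by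
  unfold negSum; rw [Finset.sum_insert h]

/-- `Σ⁺` splits off a member. -/
theorem posSum_eq_add_erase (z : Fin n → ℤ) {s : Finset (Ray n)} {ρ : Ray n} (h : ρ ∈ s) :
    posSum z s = (lin z ρ).toNat + posSum z (s.erase ρ) :=
  (Finset.add_sum_erase _ _ h).symm

/-- `Σ⁻` splits off a member. -/
theorem negSum_eq_add_erase (z : Fin n → ℤ) {s : Finset (Ray n)} {ρ : Ray n} (h : ρ ∈ s) :
    negSum z s = (-lin z ρ).toNat + negSum z (s.erase ρ) :=
  (Finset.add_sum_erase _ _ h).symm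

/-- On a set of at most one ray the positive and negative sums cannot both be non-zero, and each is bounded by any bound on the values. -/
theorem small_cone (z : Fin n → ℤ) {R : Finset (Ray n)} (hR : R.card ≤ 1) {A B : ℤ}
    (hmax : ∀ ρ ∈ R, lin z ρ ≤ A) (hmin : ∀ ρ ∈ R, -B ≤ lin z ρ) :
    posSum z R * negSum z R = 0 ∧ posSum z R ≤ A.toNat ∧ negSum z R ≤ B.toNat := by
  rcases Finset.card_le_one_iff_subset_singleton.1 hR with ⟨r, hr⟩
  rcases Finset.subset_singleton_iff.1 hr with h0 | h1
  · subst h0; simp [posSum, negSum]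
  · subst h1
    have hmr := hmax r (Finset.mem_singleton_self r)
    have hnr := hmin r (Finset.mem_singleton_self r)
    simp only [posSum, negSum, Finset.sum_singleton]
    refine ⟨?_, ?_, ?_⟩
    · rcases le_total 0 (lin z r) with h | h
      · rw [Int.toNat_of_nonpos (neg_nonpos.2 h), Nat.mul_zero]
      · rw [Int.toNat_of_nonpos h, Nat.zero_mul]
    · exact Int.toNat_le_toNat hmr
    · exact Int.toNat_le_toNat (by linarith)

/-- Two arithmetic facts behind the strict decrease of the measure. -/
theorem arith_lt_one (b c X Y : ℕ) (hb : 1 ≤ b) : (c + X) * (b + Y) < (b + c + X) * (b + Y) := by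
  nlinarith

/-- Second arithmetic fact (the case `a ≤ b` of `child_lt`). -/
theorem arith_lt_two (X e d : ℕ) (hX : 1 ≤ X) : X * (X + e + 2 * d) < (X + e + X) * (X + e + d) := by
  nlinarith

/-- **The child replacing the maximal positive ray.**  `σ` a cone with at most three rays, `p, q ∈ σ` with `ℓ p > 0 > ℓ q`, `p` maximal and
`q` minimal for `ℓ` on `σ`; the child `insert (p + q) (σ.erase p)` of the star at `{p, q}`, IF still crossing, has strictly smaller
`(Σ⁺)(Σ⁻)`.  (Case analysis; uses `card σ ≤ 3`.) [OURS] -/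
theorem child_lt (z : Fin n → ℤ) {σ : Finset (Ray n)} (hcard : σ.card ≤ 3) {p q : Ray n} (hp : p ∈ σ) (hq : q ∈ σ)
    (hp0 : 0 < lin z p) (hq0 : lin z q < 0) (hmax : ∀ ρ ∈ σ, lin z ρ ≤ lin z p) (hmin : ∀ ρ ∈ σ, lin z q ≤ lin z ρ)
    (hC : Crossing z (insert (p + q) (σ.erase p))) :
    posSum z (insert (p + q) (σ.erase p)) * negSum z (insert (p + q) (σ.erase p)) < posSum z σ * negSum z σ := by
  classical
  have hpq : p ≠ q := by rintro rfl; exact lt_irrefl _ (hq0.trans hp0)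
  have hq' : q ∈ σ.erase p := Finset.mem_erase.2 ⟨hpq.symm, hq⟩
  obtain ⟨R, hR⟩ : ∃ R, (σ.erase p).erase q = R := ⟨_, rfl⟩
  have hRcard : R.card ≤ 1 := by
    have h1 := Finset.card_erase_of_mem hq'
    have h2 := Finset.card_erase_of_mem hp
    rw [← hR, h1, h2]; omega
  -- the values `a = ℓ p`, `b = -ℓ q` as naturals
  obtain ⟨a, ha⟩ : ∃ a : ℕ, lin z p = a := ⟨(lin z p).toNat, (Int.toNat_of_nonneg hp0.le).symm⟩
  obtain ⟨b, hb⟩ : ∃ b : ℕ, lin z q = -b := ⟨(-lin z q).toNat, by rw [Int.toNat_of_nonneg (by linarith)]; ring⟩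
  have ha1 : 1 ≤ a := by
    have h : (0 : ℤ) < a := ha ▸ hp0
    exact_mod_cast h
  have hb1 : 1 ≤ b := by
    have h : (0 : ℤ) < b := by rw [hb] at hq0; linarith
    exact_mod_cast h
  -- the remainder `R` of the cone: at most one ray, values in `[-b, a]`
  have hRsub : ∀ ρ ∈ R, ρ ∈ σ := fun ρ hρ => by
    rw [← hR] at hρ
    exact Finset.mem_of_mem_erase (Finset.mem_of_mem_erase hρ)
  obtain ⟨hXY, hXa, hYb⟩ := small_cone z hRcard (A := a) (B := b)
    (fun ρ hρ => ha ▸ hmax ρ (hRsub ρ hρ)) (fun ρ hρ => by have := hmin ρ (hRsub ρ hρ); rw [hb] at this; exact this)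
  rw [Int.toNat_natCast] at hXa hYb
  -- sums of the parent and of `σ.erase p`
  have hPe : posSum z (σ.erase p) = posSum z R := by
    rw [posSum_eq_add_erase z hq', hR, hb]; simp
  have hNe : negSum z (σ.erase p) = b + negSum z R := by
    rw [negSum_eq_add_erase z hq', hR, hb, neg_neg, Int.toNat_natCast]
  have hPσ : posSum z σ = a + posSum z R := by
    rw [posSum_eq_add_erase z hp, hPe, ha, Int.toNat_natCast]
  have hNσ : negSum z σ = b + negSum z R := by
    rw [negSum_eq_add_erase z hp, hNe, ha]; simp
  have hu : lin z (p + q) = (a : ℤ) - b := by rw [lin_add, ha, hb]; ring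
  rw [hPσ, hNσ]
  by_cases hmem : p + q ∈ σ.erase p
  · -- degenerate insert (cannot happen for smooth cones, harmless anyway)
    rw [Finset.insert_eq_of_mem hmem, hPe, hNe]
    nlinarith
  rw [posSum_insert z hmem, negSum_insert z hmem, hPe, hNe, hu]
  rcases le_total b a with hba | hab
  · -- `a ≥ b`: the new ray is non-negative
    obtain ⟨c, rfl⟩ := Nat.exists_eq_add_of_le hba
    have h1 : (((b + c : ℕ) : ℤ) - b).toNat = c := by push_cast; simp
    have h2 : (-(((b + c : ℕ) : ℤ) - b)).toNat = 0 := by push_cast; simp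
    rw [h1, h2, Nat.zero_add]
    exact arith_lt_one b c _ _ hb1
  · -- `a ≤ b`: the new ray is non-positive; the child is crossing only through `Σ⁺ R > 0`, hence `Σ⁻ R = 0`
    obtain ⟨d, rfl⟩ := Nat.exists_eq_add_of_le hab
    have h1 : (((a : ℕ) : ℤ) - ((a + d : ℕ) : ℤ)).toNat = 0 := by push_cast; simp
    have h2 : (-(((a : ℕ) : ℤ) - ((a + d : ℕ) : ℤ))).toNat = d := by push_cast; simp
    rw [h1, h2, Nat.zero_add]
    have hXpos : 0 < posSum z R := by
      have := ((crossing_iff_pos z _).1 hC).1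
      rwa [posSum_insert z hmem, hPe, hu, h1, Nat.zero_add] at this
    have hY0 : negSum z R = 0 := by
      rcases Nat.mul_eq_zero.1 hXY with h | h
      · exact absurd h (Nat.pos_iff_ne_zero.1 hXpos)
      · exact h
    simp only [hY0, Nat.add_zero]
    obtain ⟨e, he⟩ := Nat.exists_eq_add_of_le hXa
    rw [he]
    have := arith_lt_two (posSum z R) e d hXpos
    have hrw : posSum z R * (d + (posSum z R + e + d)) = posSum z R * (posSum z R + e + 2 * d) := by ring
    rw [hrw]; exact this

/-- The other child `insert (p + q) (σ.erase q)` (replace the minimal ray): by the symmetry `z ↦ -z`, `p ↔ q`. [OURS] -/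
theorem child_lt' (z : Fin n → ℤ) {σ : Finset (Ray n)} (hcard : σ.card ≤ 3) {p q : Ray n} (hp : p ∈ σ) (hq : q ∈ σ)
    (hp0 : 0 < lin z p) (hq0 : lin z q < 0) (hmax : ∀ ρ ∈ σ, lin z ρ ≤ lin z p) (hmin : ∀ ρ ∈ σ, lin z q ≤ lin z ρ)
    (hC : Crossing z (insert (p + q) (σ.erase q))) :
    posSum z (insert (p + q) (σ.erase q)) * negSum z (insert (p + q) (σ.erase q)) < posSum z σ * negSum z σ := by
  have h := child_lt (-z) hcard hq hp (by rw [lin_neg]; linarith) (by rw [lin_neg]; linarith)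
    (fun ρ hρ => by rw [lin_neg, lin_neg]; linarith [hmin ρ hρ]) (fun ρ hρ => by rw [lin_neg, lin_neg]; linarith [hmax ρ hρ])
    (by rw [add_comm, crossing_neg_iff]; exact hC)
  rw [add_comm q p, posSum_neg, negSum_neg, posSum_neg, negSum_neg] at h
  rw [Nat.mul_comm, Nat.mul_comm (posSum z σ)]; exact h

/-- The weight of a crossing cone with `p` maximal-positive and `q` minimal-negative strictly exceeds the total weight of its two children
under the star at `{p, q}`. [OURS] -/
theorem weight_children_lt (z : Fin n → ℤ) {σ : Finset (Ray n)} (hcard : σ.card ≤ 3) {p q : Ray n} (hp : p ∈ σ) (hq : q ∈ σ)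
    (hp0 : 0 < lin z p) (hq0 : lin z q < 0) (hmax : ∀ ρ ∈ σ, lin z ρ ≤ lin z p) (hmin : ∀ ρ ∈ σ, lin z q ≤ lin z ρ) :
    weight z (insert (p + q) (σ.erase p)) + weight z (insert (p + q) (σ.erase q)) < weight z σ := by
  have hσ : Crossing z σ := ⟨⟨p, hp, hp0⟩, ⟨q, hq, hq0⟩⟩
  have hΦ : 1 ≤ posSum z σ * negSum z σ := by
    obtain ⟨h1, h2⟩ := (crossing_iff_pos z σ).1 hσ
    exact Nat.one_le_iff_ne_zero.2 (Nat.mul_ne_zero (Nat.pos_iff_ne_zero.1 h1) (Nat.pos_iff_ne_zero.1 h2))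
  have hb : ∀ (C : Finset (Ray n)), (Crossing z C → posSum z C * negSum z C < posSum z σ * negSum z σ) →
      weight z C ≤ 3 ^ (posSum z σ * negSum z σ - 1) := by
    intro C hC
    unfold weight
    split_ifs with h
    · exact Nat.pow_le_pow_right (by norm_num) (by have := hC h; omega)
    · exact Nat.zero_le _
  have h1 := hb _ (child_lt z hcard hp hq hp0 hq0 hmax hmin)
  have h2 := hb _ (child_lt' z hcard hp hq hp0 hq0 hmax hmin)
  have hw : weight z σ = 3 ^ (posSum z σ * negSum z σ) := if_pos hσ
  rw [hw]
  obtain ⟨m, hm⟩ := Nat.exists_eq_add_of_le hΦ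
  rw [hm, Nat.add_sub_cancel_left] at h1 h2
  rw [hm, Nat.pow_add, pow_one]
  have h3 : 0 < 3 ^ m := pow_pos (by norm_num) m
  omega

/-! ### The measure under a star -/

/-- The measure of `insert x S` is at most the weight of `x` plus the measure of `S`. -/
theorem measure_insert_le (z : Fin n → ℤ) (x : Finset (Ray n)) (S : Finset (Finset (Ray n))) :
    measure z (insert x S) ≤ weight z x + measure z S := by
  classical
  unfold measure
  by_cases h : x ∈ S
  · rw [Finset.insert_eq_of_mem h]; exact Nat.le_add_left _ _
  · rw [Finset.sum_insert h]

/-- The measure of a union is at most the sum of the measures. -/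
theorem measure_union_le (z : Fin n → ℤ) (A B : Finset (Finset (Ray n))) :
    measure z (A ∪ B) ≤ measure z A + measure z B := by
  classical
  unfold measure
  rw [← Finset.sum_union_inter]
  exact Nat.le_add_right _ _

/-- The measure of a `biUnion` is at most the sum of the measures of the pieces. -/
theorem measure_biUnion_le (z : Fin n → ℤ) (S : Finset (Finset (Ray n))) (g : Finset (Ray n) → Finset (Finset (Ray n))) :
    measure z (S.biUnion g) ≤ ∑ σ ∈ S, measure z (g σ) := by
  classical
  induction S using Finset.induction_on with
  | empty => simp [measure]
  | insert a S ha ih =>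
    rw [Finset.biUnion_insert, Finset.sum_insert ha]
    exact (measure_union_le z _ _).trans (Nat.add_le_add_left ih _)

/-- **One star at the globally extreme crossing pair strictly lowers the measure.** [OURS] -/
theorem measure_star_lt (z : Fin n → ℤ) {F : Finset (Finset (Ray n))} (hcard : ∀ σ ∈ F, σ.card ≤ 3) {p q : Ray n}
    (hp0 : 0 < lin z p) (hq0 : lin z q < 0)
    (hext : ∀ σ ∈ F, p ∈ σ → q ∈ σ → (∀ ρ ∈ σ, lin z ρ ≤ lin z p) ∧ (∀ ρ ∈ σ, lin z q ≤ lin z ρ))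
    {σ₀ : Finset (Ray n)} (hσ₀ : σ₀ ∈ F) (hp : p ∈ σ₀) (hq : q ∈ σ₀) :
    measure z (star F ({p, q} : Finset (Ray n))) < measure z F := by
  classical
  have hpq : p ≠ q := by rintro rfl; exact lt_irrefl _ (hq0.trans hp0)
  have hsum : ∑ ρ ∈ ({p, q} : Finset (Ray n)), ρ = p + q := Finset.sum_pair hpq
  have hsub : ∀ σ : Finset (Ray n), ({p, q} : Finset (Ray n)) ⊆ σ ↔ p ∈ σ ∧ q ∈ σ := fun σ => by
    rw [Finset.insert_subset_iff, Finset.singleton_subset_iff]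
  -- the replacement of a cone through `{p, q}` costs strictly less than the cone
  have key : ∀ σ ∈ F, ({p, q} : Finset (Ray n)) ⊆ σ →
      measure z (({p, q} : Finset (Ray n)).image (fun t => insert (∑ ρ ∈ ({p, q} : Finset (Ray n)), ρ) (σ.erase t)))
        < weight z σ := by
    intro σ hσ h
    obtain ⟨hpσ, hqσ⟩ := (hsub σ).1 h
    obtain ⟨hmax, hmin⟩ := hext σ hσ hpσ hqσ
    rw [hsum, Finset.image_insert, Finset.image_singleton]
    refine lt_of_le_of_lt (measure_insert_le z _ _) ?_
    unfold measure; rw [Finset.sum_singleton]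
    exact weight_children_lt z (hcard σ hσ) hpσ hqσ hp0 hq0 hmax hmin
  -- the measure of the star is bounded by the total replacement cost
  have hle : measure z (star F ({p, q} : Finset (Ray n))) ≤ ∑ σ ∈ F,
      (if ({p, q} : Finset (Ray n)) ⊆ σ then
        measure z (({p, q} : Finset (Ray n)).image (fun t => insert (∑ ρ ∈ ({p, q} : Finset (Ray n)), ρ) (σ.erase t)))
       else weight z σ) := by
    unfold star
    refine (measure_union_le z _ _).trans ?_
    refine (Nat.add_le_add_left (measure_biUnion_le z _ _) _).trans (le_of_eq ?_)
    have h1 : measure z (F.filter (fun σ => ¬ ({p, q} : Finset (Ray n)) ⊆ σ)) =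
        ∑ σ ∈ F.filter (fun σ => ¬ ({p, q} : Finset (Ray n)) ⊆ σ),
          (if ({p, q} : Finset (Ray n)) ⊆ σ then
            measure z (({p, q} : Finset (Ray n)).image (fun t => insert (∑ ρ ∈ ({p, q} : Finset (Ray n)), ρ) (σ.erase t)))
           else weight z σ) :=
      Finset.sum_congr rfl (fun σ hσ => by rw [if_neg (Finset.mem_filter.1 hσ).2])
    have h2 : ∑ σ ∈ F.filter (fun σ => ({p, q} : Finset (Ray n)) ⊆ σ),
          measure z (({p, q} : Finset (Ray n)).image (fun t => insert (∑ ρ ∈ ({p, q} : Finset (Ray n)), ρ) (σ.erase t))) =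
        ∑ σ ∈ F.filter (fun σ => ({p, q} : Finset (Ray n)) ⊆ σ),
          (if ({p, q} : Finset (Ray n)) ⊆ σ then
            measure z (({p, q} : Finset (Ray n)).image (fun t => insert (∑ ρ ∈ ({p, q} : Finset (Ray n)), ρ) (σ.erase t)))
           else weight z σ) :=
      Finset.sum_congr rfl (fun σ hσ => by rw [if_pos (Finset.mem_filter.1 hσ).2])
    rw [h1, h2, add_comm, Finset.sum_filter_add_sum_filter_not]
  refine lt_of_le_of_lt hle (Finset.sum_lt_sum (fun σ hσ => ?_) ⟨σ₀, hσ₀, ?_⟩)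
  · by_cases h : ({p, q} : Finset (Ray n)) ⊆ σ
    · rw [if_pos h]; exact (key σ hσ h).le
    · rw [if_neg h]
  · rw [if_pos ((hsub σ₀).2 ⟨hp, hq⟩)]
    exact key σ₀ hσ₀ ((hsub σ₀).2 ⟨hp, hq⟩)

end FanGame

end Summit.ResolutionOfSingularities.ResolutionOfSingularities.Cruxes.EquisingularLiftNat.Sections
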